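import Summits.BirchSwinnertonDyer.BirchSwinnertonDyer.Theorems.KimAtThreeCyclotomicSigmaFrobenius
import Summits.BirchSwinnertonDyer.BirchSwinnertonDyer.Theorems.KimAtThreeSemiLocalTraceDualTwistLocalLattice
import Literature.NumberTheory.EllipticCurves.ComplexMultiplicationDeuringFrobeniusProofs
import HarnessLib

/-!
# The TWISTED per-factor `exp*` bound on a good-anomalous row of `ℚ(ζ_m)_𝔓`:
# `Tr(log_ω E(L_𝔓) · x) ⊆ 𝒪_v ⟹ p·x ∈ P_w^loc · 𝒪_𝔓 = p·E_p(φ⁻¹)𝒪_𝔓`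

Cell `bsd-addord`, seat `bsd-addord-w2-acc3` (PROGRAMME PART 1b row (3), gen 8); `--supports
stmt-BirchSwinnertonDyer-19679` (helper). TOOL theorems only (no definition, no instance, no named fact, no
`sorry`); closes nothing by itself; nothing booked; BSD / 19679 / 19599 / 20397 are not proved by any of this.

WHY. Step 1 of seat w2-c4 gen 11's road (2) for support item 20397 `FineKatoTauAnomalousThree` (the
good-ANOMALOUS `t = 0` rows of 19599 / 19077 / 19679): «acc3 g7's E-side Euler lattice lemma gives
`log_ω E(L_w) = E_p(φ)⁻¹𝒪_w` at tame unramified `w`; combine with (S5b-tower) (trace dual) to get the TWISTED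
per-factor bound». The (S5b-tower) output at a factor field `L_𝔓` is, for the value `x = exp*_{dw}(z)` of a
class, the statement `hx : ∀ P ∈ E(L_𝔓), Tr_{L_𝔓/ℚ_v}(log_ω P · x) ∈ 𝒪_v` (w2-c4's `hrange` / `hdual'`, read
through `Kw.trace_adicCompletionPadicAlgebra_eq` + `mem_adicCompletionIntegers_of_norm_symm_le_one`). THIS FILE
turns `hx` into the twisted membership, entirely on the E-side of the cut (no cohomology, no `exp*`, no line
datum in the statement): for `L = ℚ(ζ_m)`, `p ∤ m`, `𝔓 ∣ p`, `u ≡ p`, `w·p ≡ 1 (mod m)`, and a good-anomalous row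
(`p ≥ 3`, `p ∤ Δ_min`, `p ∣ a_p − 1`, `#E(ℚ_p)[p] = 1`),

* ★★ `exists_eq_eulerTwistLoc_of_forall_trace_padicLog_mul_mem` — **`hx ⟹ ∃ z ∈ 𝒪_𝔓,
  p·x = p·z − a_p·(σ_w)_𝔓 z + (σ_w)_𝔓((σ_w)_𝔓 z)`**, i.e. `p·x ∈ P_w^loc·𝒪_𝔓` with `P_w = p − a·σ_w + σ_w²`
  the Euler factor of item 20397's compatibility clause read at `𝔓` (gen 6 `padicTensor_eulerTwist_apply`).
  Proof: the «⟹» half of my gen-6 ★★★ `forall_trace_mul_mem_iff_exists_eq_eulerTwistLoc_smul`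
  (`(E_p(φ)⁻¹𝒪_𝔓)^∨ = E_p(φ⁻¹)𝒪_𝔓`, needs `a ≠ ±(p+1)`: Hasse `DeuringLadic.frobeniusTrace_sq_le`) fed by the
  «⊇» half of the lattice lemma in the `sigma` currency (`exists_padicLog_eq_iff_sigma_of_natCard_eq_one`,
  p535199): every `o` with `P_u^loc o ∈ p𝒪_𝔓` IS a `log_ω P`.
* `frobeniusTrace_ne_of_sq_le` (`a_p ≠ ±(p+1)` from Hasse), `norm_eulerOperator_le_of_eq`
  (the `L_𝔓`-membership `P_u^loc o = p·o'`, `o' ∈ 𝒪_𝔓` ⇒ the `K_𝔓`-norm bound `‖φφy − a·φy + p·y‖ ≤ ‖p‖`).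

What the 20397 discharger adds on the Kato side (not here): `x := exp*_{dw}(z)` with (S5b-tower) ⇒ `hx`
(w2-c4 `KimAtThreeShallowEqDeepTraceDualLattice` pattern), transport along `S_w`, and the semi-local
assembly `Ψ⁻¹` (gen 6 `eulerTwist_mem_cycIntLattice_iff_forall`).

References: C.-H. Kim, *AJM* 148 (2026) Lemma 3.4, Cor. 3.5, §3.4.1 [Kim2022StructureSelmer]; S. Bloch,
K. Kato (1990) Prop. 3.8, Example 3.11 [BlochKato1990]; J. H. Silverman, *AEC* (2009) V.1.1, IV.6.4
[SilvermanAEC2009]; L. C. Washington (1997) Thm. 2.13 [Washington1997].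
-/

set_option autoImplicit false
-- the cell's Theorems namespace `Summit.BirchSwinnertonDyer.BirchSwinnertonDyer.…` repeats the summit name by design (D-0017)
set_option linter.dupNamespace false
-- `CyclotomicField m ℚ`'s two `ℚ`-algebra structures agree only up to unfolding (as in the sibling files)
set_option backward.isDefEq.respectTransparency false

noncomputable section

open scoped Classical NNReal NumberField TensorProduct
open IsDedekindDomain NumberField
open Literature.NumberTheory.Automorphic Literature.NumberTheory.AdelicBaseChange
open Literature.NumberTheory.EllipticCurves.Kato2004.EulerSystemValues (sigma)
open Literature.NumberTheory.GaloisRepresentations.LubinTate (unitBall mem_unitBall_iff)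
open Summit.BirchSwinnertonDyer.BirchSwinnertonDyer.Theorems.KPort
open Summit.BirchSwinnertonDyer.BirchSwinnertonDyer.Theorems.KimAtThreeSemiLocalTraceDualTwistLocal
open Summit.BirchSwinnertonDyer.BirchSwinnertonDyer.Theorems.KimAtThreeSemiLocalTraceDualTwistLocalLattice
open Summit.BirchSwinnertonDyer.BirchSwinnertonDyer.Theorems.KimAtThreeCyclotomicSigmaFrobenius

namespace Summit.BirchSwinnertonDyer.BirchSwinnertonDyer.Theorems.KimAtThreeCyclotomicTwistedExpStarBound

variable (m : ℕ) [NeZero m] (p : ℕ) [hp : Fact p.Prime]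

/-! ## §1 Two small inputs: Hasse ⇒ `a_p ≠ ±(p+1)`, and the `L_𝔓`-to-`K_𝔓` norm transport -/

omit [NeZero m] in
/-- **`a_p ≠ p + 1` and `a_p ≠ −(p + 1)` at a good prime** of a globally minimal `W/ℚ`: Hasse's `a_p² ≤ 4p`
(tree `DeuringLadic.frobeniusTrace_sq_le`) and `4p < (p+1)²`. [cite: SilvermanAEC2009, Thm. V.1.1] -/
theorem frobeniusTrace_ne_of_sq_le (W : WeierstrassCurve ℚ) [W.IsElliptic] [W.IsGloballyMinimal]
    (hΔ : ¬ (p : ℤ) ∣ WeierstrassCurve.minimalDiscriminantInt W) :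
    W.frobeniusTrace p ≠ (p : ℤ) + 1 ∧ W.frobeniusTrace p ≠ -((p : ℤ) + 1) := by
  have hH := Literature.NumberTheory.EllipticCurves.DeuringLadic.frobeniusTrace_sq_le W hp.out hΔ
  have hp2 : (2 : ℤ) ≤ p := by exact_mod_cast hp.out.two_le
  constructor
  · intro h
    rw [h] at hH
    nlinarith
  · intro h
    rw [h] at hH
    nlinarith

/-- **Norm transport `L_𝔓 → K_𝔓` of the Euler-operator membership**: if `φ` on `K_𝔓` agrees with the ring map
`S` on `L_𝔓` and `S(S o) − a·S o + p·o = p·o'` … stated as `p·o − a·S o + S(S o) = p·o'` with `o' ∈ 𝒪_𝔓`, then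
for `y := o` read in `K_𝔓`: `‖φ(φ y) − a·φ y + p·y‖ ≤ ‖p‖`. [folklore] -/
theorem norm_eulerOperator_le_of_eq {L : Type} [Field L] [NumberField L]
    {w : ((Rat.HeightOneSpectrum.primesEquiv (R := 𝓞 ℚ)).symm ⟨p, hp.out⟩).Extension (𝓞 L)}
    (S : w.1.adicCompletion L →+* w.1.adicCompletion L)
    (φ : Kw p L w →ₐ[ℚ_[p]] Kw p L w) (hφ : ∀ y, Kw.toCompletion p L w (φ y) = S (Kw.toCompletion p L w y))
    (a : ℤ) (o o' : w.1.adicCompletion L) (ho' : o' ∈ w.1.adicCompletionIntegers L)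
    (h : (p : w.1.adicCompletion L) * o - (a : w.1.adicCompletion L) * S o + S (S o) =
      (p : w.1.adicCompletion L) * o') :
    ‖φ (φ ((Kw.toCompletion p L w).symm o)) - (a : Kw p L w) * φ ((Kw.toCompletion p L w).symm o)
        + (p : Kw p L w) * (Kw.toCompletion p L w).symm o‖ ≤ ‖(p : Kw p L w)‖ := by
  have hy : Kw.toCompletion p L w ((Kw.toCompletion p L w).symm o) = o := RingEquiv.apply_symm_apply _ o
  have heq : φ (φ ((Kw.toCompletion p L w).symm o)) - (a : Kw p L w) * φ ((Kw.toCompletion p L w).symm o)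
        + (p : Kw p L w) * (Kw.toCompletion p L w).symm o =
      (p : Kw p L w) * (Kw.toCompletion p L w).symm o' := by
    apply (Kw.toCompletion p L w).injective
    rw [map_add, map_sub, map_mul, map_mul, map_mul, hφ, hφ, hy, map_intCast, map_natCast,
      RingEquiv.apply_symm_apply]
    rw [← h]; ring
  have ho'1 : ‖(Kw.toCompletion p L w).symm o'‖ ≤ 1 := by
    rw [← mem_unitBall_iff, Kw.mem_unitBall_iff_mem_adicCompletionIntegers, RingEquiv.apply_symm_apply]
    exact ho'
  rw [heq, norm_mul]
  exact mul_le_of_le_one_right (norm_nonneg _) ho'1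

/-! ## §2 The twisted per-factor bound -/

variable (W : WeierstrassCurve ℚ) [W.IsElliptic] [W.IsGloballyMinimal]

/-- ★★ **The TWISTED per-factor bound on a good-anomalous row.** `L = ℚ(ζ_m)`, `p ∤ m`, `𝔓 ∣ p`; `u, w ∈ (ℤ/m)ˣ`
with `u ≡ p` and `w·p ≡ 1`; `W/ℚ` globally minimal, `p ≥ 3`, `p ∤ Δ_min(W)`, `a_p ≡ 1 (mod p)`, `#E(ℚ_p)[p] = 1`.
If `x ∈ L_𝔓` pairs integrally with every logarithm — `Tr_{L_𝔓/ℚ_v}(log_ω P · x) ∈ 𝒪_v` for all `P ∈ E(L_𝔓)`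
(the (S5b) shape of a dual-exponential value) — then **`p·x = p·z − a_p·(σ_w)_𝔓 z + (σ_w)_𝔓((σ_w)_𝔓 z)` for
some `z ∈ 𝒪_𝔓`**, i.e. `p·x ∈ P_w^loc·𝒪_𝔓 = p·E_p(φ⁻¹)·𝒪_𝔓` (`φ = (σ_u)_𝔓` the Frobenius, `(σ_w)_𝔓 = φ⁻¹`).
Composition of the lattice lemma (`⊇` half) and the duality `(E_p(φ)⁻¹𝒪_𝔓)^∨ = E_p(φ⁻¹)𝒪_𝔓`.
[cite: Kim2022StructureSelmer, Lemma 3.4, Cor. 3.5 and §3.4.1] [cite: BlochKato1990, Prop. 3.8 and Example 3.11] -/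
theorem exists_eq_eulerTwistLoc_of_forall_trace_padicLog_mul_mem (hpm : ¬ p ∣ m) (u w' : (ZMod m)ˣ)
    (hu : (u : ZMod m) = (p : ZMod m)) (hw' : (w' : ZMod m) * ((p : ℕ) : ZMod m) = 1)
    (𝔓 : ((Rat.HeightOneSpectrum.primesEquiv (R := 𝓞 ℚ)).symm ⟨p, hp.out⟩).Extension
      (𝓞 (CyclotomicField m ℚ)))
    (hp3 : 3 ≤ p) (hΔ : ¬ (p : ℤ) ∣ WeierstrassCurve.minimalDiscriminantInt W)
    (hap : (p : ℤ) ∣ W.frobeniusTrace p - 1)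
    (ht : Nat.card {Q : (W.baseChange ℚ_[p]).toAffine.Point // (p : ℕ) • Q = 0} = 1)
    (x : 𝔓.1.adicCompletion (CyclotomicField m ℚ))
    (hx : haveI := Literature.NumberTheory.EllipticCurves.EulerLattice.isIntegral_baseChange 𝔓.1 W
      ∀ P : (W.baseChange (𝔓.1.adicCompletion (CyclotomicField m ℚ))).toAffine.Point,
        Algebra.trace (((Rat.HeightOneSpectrum.primesEquiv (R := 𝓞 ℚ)).symm ⟨p, hp.out⟩).adicCompletion ℚ)
            (𝔓.1.adicCompletion (CyclotomicField m ℚ))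
          (x * Literature.NumberTheory.EllipticCurves.FormalGroupChart.padicLogPointFiniteExt
              (NormedField.valuation : Valuation (𝔓.1.adicCompletion (CyclotomicField m ℚ)) ℝ≥0)
              (W.baseChange (𝔓.1.adicCompletion (CyclotomicField m ℚ))) p P) ∈
        (((Rat.HeightOneSpectrum.primesEquiv (R := 𝓞 ℚ)).symm ⟨p, hp.out⟩).adicCompletionIntegers ℚ)) :
    ∃ z ∈ 𝔓.1.adicCompletionIntegers (CyclotomicField m ℚ),
      (p : 𝔓.1.adicCompletion (CyclotomicField m ℚ)) * x =
        (p : 𝔓.1.adicCompletion (CyclotomicField m ℚ)) * z -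
        (W.frobeniusTrace p : 𝔓.1.adicCompletion (CyclotomicField m ℚ)) *
          galAdicCompletionMap (sigma m w') (sigma_smul_eq_self_of_mul_coe_eq_one m p hpm w' hw' 𝔓) z +
        galAdicCompletionMap (sigma m w') (sigma_smul_eq_self_of_mul_coe_eq_one m p hpm w' hw' 𝔓)
          (galAdicCompletionMap (sigma m w') (sigma_smul_eq_self_of_mul_coe_eq_one m p hpm w' hw' 𝔓) z) := by
  haveI := Literature.NumberTheory.EllipticCurves.EulerLattice.isIntegral_baseChange 𝔓.1 W
  haveI := HeightOneSpectrum.Extension.fintype (𝓞 ℚ) ℚ (CyclotomicField m ℚ) (𝓞 (CyclotomicField m ℚ))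
    ((Rat.HeightOneSpectrum.primesEquiv (R := 𝓞 ℚ)).symm ⟨p, hp.out⟩)
  obtain ⟨ha, ha'⟩ := frobeniusTrace_ne_of_sq_le p W hΔ
  refine (forall_trace_mul_mem_iff_exists_eq_eulerTwistLoc_smul m p hpm u w' hu hw' ha ha' 𝔓 x).mp ?_
  rintro o ⟨o', ho', hPo⟩
  -- `o` IS a logarithm: the «⊇» half of the lattice lemma at `φ = (σ_u)_𝔓`
  obtain ⟨φ, hφ, -⟩ := exists_frobenius_sigma m p hpm u hu 𝔓
  have hnorm := norm_eulerOperator_le_of_eq p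
    (galAdicCompletionMap (sigma m u) (sigma_smul_eq_self_of_coe_eq m p hpm u hu 𝔓)) φ hφ
    (W.frobeniusTrace p) o o' ho' hPo
  obtain ⟨P, hP⟩ := (exists_padicLog_eq_iff_sigma_of_natCard_eq_one m p W hpm u hu 𝔓 hp3 hΔ hap ht φ hφ
    ((Kw.toCompletion p (CyclotomicField m ℚ) 𝔓).symm o)).mpr hnorm
  have hPo' : Literature.NumberTheory.EllipticCurves.FormalGroupChart.padicLogPointFiniteExt
      (NormedField.valuation : Valuation (𝔓.1.adicCompletion (CyclotomicField m ℚ)) ℝ≥0)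
      (W.baseChange (𝔓.1.adicCompletion (CyclotomicField m ℚ))) p P = o := by
    rw [hP, RingEquiv.apply_symm_apply]
  have h := hx P
  rw [hPo'] at h
  rwa [mul_comm] at h

/-- **The same for ANY compatible `ℝ≥0`-valuation `ν` of `L_𝔓` making the model integral** (e.g. w2-c4's
`Kwe`-norm, the currency of its `hrange`): `log_ω` does not depend on the choice
(`padicLogPointFiniteExt_apply_eq_of_isEquiv`). [cite: Kim2022StructureSelmer, Lemma 3.4, Cor. 3.5 and §3.4.1]
[cite: SilvermanAEC2009, Thm. IV.6.4 with Prop. VII.2.2] -/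
theorem exists_eq_eulerTwistLoc_of_forall_trace_padicLog_mul_mem' (hpm : ¬ p ∣ m) (u w' : (ZMod m)ˣ)
    (hu : (u : ZMod m) = (p : ZMod m)) (hw' : (w' : ZMod m) * ((p : ℕ) : ZMod m) = 1)
    (𝔓 : ((Rat.HeightOneSpectrum.primesEquiv (R := 𝓞 ℚ)).symm ⟨p, hp.out⟩).Extension
      (𝓞 (CyclotomicField m ℚ)))
    (hp3 : 3 ≤ p) (hΔ : ¬ (p : ℤ) ∣ WeierstrassCurve.minimalDiscriminantInt W)
    (hap : (p : ℤ) ∣ W.frobeniusTrace p - 1)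
    (ht : Nat.card {Q : (W.baseChange ℚ_[p]).toAffine.Point // (p : ℕ) • Q = 0} = 1)
    (ν : Valuation (𝔓.1.adicCompletion (CyclotomicField m ℚ)) ℝ≥0) [ν.Compatible]
    [hν : (W.baseChange (𝔓.1.adicCompletion (CyclotomicField m ℚ))).IsIntegral ν.integer]
    (x : 𝔓.1.adicCompletion (CyclotomicField m ℚ))
    (hx : ∀ P : (W.baseChange (𝔓.1.adicCompletion (CyclotomicField m ℚ))).toAffine.Point,
        Algebra.trace (((Rat.HeightOneSpectrum.primesEquiv (R := 𝓞 ℚ)).symm ⟨p, hp.out⟩).adicCompletion ℚ)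
            (𝔓.1.adicCompletion (CyclotomicField m ℚ))
          (x * Literature.NumberTheory.EllipticCurves.FormalGroupChart.padicLogPointFiniteExt ν
              (W.baseChange (𝔓.1.adicCompletion (CyclotomicField m ℚ))) p P) ∈
        (((Rat.HeightOneSpectrum.primesEquiv (R := 𝓞 ℚ)).symm ⟨p, hp.out⟩).adicCompletionIntegers ℚ)) :
    ∃ z ∈ 𝔓.1.adicCompletionIntegers (CyclotomicField m ℚ),
      (p : 𝔓.1.adicCompletion (CyclotomicField m ℚ)) * x =
        (p : 𝔓.1.adicCompletion (CyclotomicField m ℚ)) * z -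
        (W.frobeniusTrace p : 𝔓.1.adicCompletion (CyclotomicField m ℚ)) *
          galAdicCompletionMap (sigma m w') (sigma_smul_eq_self_of_mul_coe_eq_one m p hpm w' hw' 𝔓) z +
        galAdicCompletionMap (sigma m w') (sigma_smul_eq_self_of_mul_coe_eq_one m p hpm w' hw' 𝔓)
          (galAdicCompletionMap (sigma m w') (sigma_smul_eq_self_of_mul_coe_eq_one m p hpm w' hw' 𝔓) z) := by
  haveI := Literature.NumberTheory.EllipticCurves.EulerLattice.isIntegral_baseChange 𝔓.1 W
  -- `ν` and Mathlib's norm valuation of `L_𝔓` are equivalent: same `log_ω`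
  have h1 : (NormedField.valuation : Valuation (𝔓.1.adicCompletion (CyclotomicField m ℚ)) ℝ≥0).IsEquiv
      (Valued.v : Valuation (𝔓.1.adicCompletion (CyclotomicField m ℚ)) (WithZero (Multiplicative ℤ))) := by
    rw [Valuation.isEquiv_iff_val_le_one]
    intro y
    rw [NormedField.valuation_apply, ← NNReal.coe_le_coe, coe_nnnorm, NNReal.coe_one,
      Valued.toNormedField.norm_le_one_iff]
  have h2 : ν.IsEquiv
      (Valued.v : Valuation (𝔓.1.adicCompletion (CyclotomicField m ℚ)) (WithZero (Multiplicative ℤ))) :=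
    ValuativeRel.isEquiv ν _
  have hequiv := h2.trans h1.symm
  refine exists_eq_eulerTwistLoc_of_forall_trace_padicLog_mul_mem m p W hpm u w' hu hw' 𝔓 hp3 hΔ hap ht x ?_
  intro P
  rw [← Literature.NumberTheory.EllipticCurves.FormalGroupChart.padicLogPointFiniteExt_apply_eq_of_isEquiv
    hequiv p P]
  exact hx P

/-! ## §3 The semi-local twisted bound along `Ψ : ℚ_p ⊗ ℚ(ζ_m) ≅ ∏_𝔓 ℚ(ζ_m)_𝔓` -/

/-- ★★ **The SEMI-LOCAL twisted bound**: for `v ∈ ℚ_p ⊗_ℚ ℚ(ζ_m)` (`p ∤ m`) whose every component `Ψ(v)_𝔓`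
pairs integrally with `log_ω E(L_𝔓)` (the (S5b-tower) output, factor by factor), on a good-anomalous row:
**`p · v = P_w · l` for some `l ∈ L_int = cycIntLattice p m`**, `P_w · l := Σ_g coeff_g(p − a·[w] + [w²]) · (1 ⊗ σ_g) l`
— literally the right-hand side shape of item 20397's compatibility clause. Proof: §2 at every `𝔓`, then
`l := Ψ⁻¹(z)` (`L_int = Ψ⁻¹ ∏ 𝒪_𝔓`, gen 6 `mem_cycIntLattice_iff_forall_padicTensor_mem`) and
`Ψ(P_w · l)_𝔓 = P_w^loc z_𝔓` (gen 6 `padicTensor_eulerTwist_apply`).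
[cite: Kim2022StructureSelmer, §3.4.1 and the proof of Thm. 3.13] [cite: CasselsFrohlichANT1967, Ch. II §10 (10.2)] -/
theorem exists_mem_cycIntLattice_eulerTwist_eq_of_forall (hpm : ¬ p ∣ m) (u w' : (ZMod m)ˣ)
    (hu : (u : ZMod m) = (p : ZMod m)) (hw' : (w' : ZMod m) * ((p : ℕ) : ZMod m) = 1)
    (Ψ : ℚ_[p] ⊗[ℚ] CyclotomicField m ℚ ≃ₐ[ℚ]
      (Π 𝔓 : ((Rat.HeightOneSpectrum.primesEquiv (R := 𝓞 ℚ)).symm ⟨p, hp.out⟩).Extension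
        (𝓞 (CyclotomicField m ℚ)), 𝔓.1.adicCompletion (CyclotomicField m ℚ)))
    (hΨ : ∀ (s : ℚ_[p]) (x : CyclotomicField m ℚ)
      (𝔓 : ((Rat.HeightOneSpectrum.primesEquiv (R := 𝓞 ℚ)).symm ⟨p, hp.out⟩).Extension
        (𝓞 (CyclotomicField m ℚ))),
      Ψ (s ⊗ₜ[ℚ] x) 𝔓 = algebraMap (CyclotomicField m ℚ) (𝔓.1.adicCompletion (CyclotomicField m ℚ)) x *
        algebraMap (((Rat.HeightOneSpectrum.primesEquiv (R := 𝓞 ℚ)).symm ⟨p, hp.out⟩).adicCompletion ℚ)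
          (𝔓.1.adicCompletion (CyclotomicField m ℚ)) (Padic.adicCompletionEquiv (𝓞 ℚ) ⟨p, hp.out⟩ s))
    (hp3 : 3 ≤ p) (hΔ : ¬ (p : ℤ) ∣ WeierstrassCurve.minimalDiscriminantInt W)
    (hap : (p : ℤ) ∣ W.frobeniusTrace p - 1)
    (ht : Nat.card {Q : (W.baseChange ℚ_[p]).toAffine.Point // (p : ℕ) • Q = 0} = 1)
    (v : ℚ_[p] ⊗[ℚ] CyclotomicField m ℚ)
    (hx : ∀ 𝔓 : ((Rat.HeightOneSpectrum.primesEquiv (R := 𝓞 ℚ)).symm ⟨p, hp.out⟩).Extension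
        (𝓞 (CyclotomicField m ℚ)),
      haveI := Literature.NumberTheory.EllipticCurves.EulerLattice.isIntegral_baseChange 𝔓.1 W
      ∀ P : (W.baseChange (𝔓.1.adicCompletion (CyclotomicField m ℚ))).toAffine.Point,
        Algebra.trace (((Rat.HeightOneSpectrum.primesEquiv (R := 𝓞 ℚ)).symm ⟨p, hp.out⟩).adicCompletion ℚ)
            (𝔓.1.adicCompletion (CyclotomicField m ℚ))
          (Ψ v 𝔓 * Literature.NumberTheory.EllipticCurves.FormalGroupChart.padicLogPointFiniteExt
              (NormedField.valuation : Valuation (𝔓.1.adicCompletion (CyclotomicField m ℚ)) ℝ≥0)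
              (W.baseChange (𝔓.1.adicCompletion (CyclotomicField m ℚ))) p P) ∈
        (((Rat.HeightOneSpectrum.primesEquiv (R := 𝓞 ℚ)).symm ⟨p, hp.out⟩).adicCompletionIntegers ℚ)) :
    ∃ l ∈ Summit.BirchSwinnertonDyer.Rank1Residual.GaloisImage.cycIntLattice p m,
      ∑ g : (ZMod m)ˣ, (((((p : ℕ) : MonoidAlgebra ℤ_[p] (ZMod m)ˣ) -
        MonoidAlgebra.single w' (W.frobeniusTrace p : ℤ_[p]) + MonoidAlgebra.single (w' ^ 2) (1 : ℤ_[p])).coeff g :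
          ℤ_[p]) : ℚ_[p]) • Algebra.TensorProduct.map (AlgHom.id ℚ ℚ_[p])
            (sigma m g : CyclotomicField m ℚ →ₐ[ℚ] CyclotomicField m ℚ) l =
      (p : ℚ_[p] ⊗[ℚ] CyclotomicField m ℚ) * v := by
  classical
  choose z hz hzeq using fun 𝔓 =>
    exists_eq_eulerTwistLoc_of_forall_trace_padicLog_mul_mem m p W hpm u w' hu hw' 𝔓 hp3 hΔ hap ht (Ψ v 𝔓) (hx 𝔓)
  refine ⟨Ψ.symm z, ?_, ?_⟩
  · rw [mem_cycIntLattice_iff_forall_padicTensor_mem m p hpm Ψ hΨ]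
    intro 𝔓
    rw [AlgEquiv.apply_symm_apply]
    exact hz 𝔓
  · apply Ψ.injective
    funext 𝔓
    have h := padicTensor_eulerTwist_apply m p (Ψ : ℚ_[p] ⊗[ℚ] CyclotomicField m ℚ →ₐ[ℚ] _) hΨ w'
      (W.frobeniusTrace p) 𝔓 (sigma_smul_eq_self_of_mul_coe_eq_one m p hpm w' hw' 𝔓) (Ψ.symm z)
    rw [AlgEquiv.coe_toAlgHom] at h
    rw [h, map_mul, map_natCast, Pi.mul_apply, Pi.natCast_apply, AlgEquiv.apply_symm_apply]
    exact (hzeq 𝔓).symm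

/-! ## §4 (appended) The same bound, POLYMORPHIC in the `ℚ`-algebra structure of `L_𝔓` -/

/-- **The twisted per-factor bound for ANY `ℚ`-algebra structure on `L_𝔓` and any compatible `ν`** — the
currency of w2-c4's `hrange` (there `CharZero L_𝔓` is in scope, so `W.baseChange L_𝔓` is built on
`DivisionRing.toRatAlgebra`, not on the canonical structure of §2): ring maps `ℚ → L_𝔓` are unique, so the two
models are EQUAL (`Subsingleton.elim`, as kport's `baseChange_completion_baseChange`) and points transport with
their logarithms (kport `Kw.exists_point_padicLogPointFiniteExt_eq_of_eq`). Same conclusion as §2.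
[cite: Kim2022StructureSelmer, Lemma 3.4, Cor. 3.5 and §3.4.1] [cite: SilvermanAEC2009, Thm. IV.6.4 with Prop. VII.2.2] -/
theorem exists_eq_eulerTwistLoc_of_forall_trace_padicLog_mul_mem_of_algebra (hpm : ¬ p ∣ m) (u w' : (ZMod m)ˣ)
    (hu : (u : ZMod m) = (p : ZMod m)) (hw' : (w' : ZMod m) * ((p : ℕ) : ZMod m) = 1)
    (𝔓 : ((Rat.HeightOneSpectrum.primesEquiv (R := 𝓞 ℚ)).symm ⟨p, hp.out⟩).Extension
      (𝓞 (CyclotomicField m ℚ)))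
    (hp3 : 3 ≤ p) (hΔ : ¬ (p : ℤ) ∣ WeierstrassCurve.minimalDiscriminantInt W)
    (hap : (p : ℤ) ∣ W.frobeniusTrace p - 1)
    (ht : Nat.card {Q : (W.baseChange ℚ_[p]).toAffine.Point // (p : ℕ) • Q = 0} = 1)
    [instQ : Algebra ℚ (𝔓.1.adicCompletion (CyclotomicField m ℚ))]
    (ν : Valuation (𝔓.1.adicCompletion (CyclotomicField m ℚ)) ℝ≥0) [ν.Compatible]
    [(W.baseChange (𝔓.1.adicCompletion (CyclotomicField m ℚ))).IsIntegral ν.integer]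
    (x : 𝔓.1.adicCompletion (CyclotomicField m ℚ))
    (hx : ∀ P : (W.baseChange (𝔓.1.adicCompletion (CyclotomicField m ℚ))).toAffine.Point,
        Algebra.trace (((Rat.HeightOneSpectrum.primesEquiv (R := 𝓞 ℚ)).symm ⟨p, hp.out⟩).adicCompletion ℚ)
            (𝔓.1.adicCompletion (CyclotomicField m ℚ))
          (x * Literature.NumberTheory.EllipticCurves.FormalGroupChart.padicLogPointFiniteExt ν
              (W.baseChange (𝔓.1.adicCompletion (CyclotomicField m ℚ))) p P) ∈
        (((Rat.HeightOneSpectrum.primesEquiv (R := 𝓞 ℚ)).symm ⟨p, hp.out⟩).adicCompletionIntegers ℚ)) :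
    ∃ z ∈ 𝔓.1.adicCompletionIntegers (CyclotomicField m ℚ),
      (p : 𝔓.1.adicCompletion (CyclotomicField m ℚ)) * x =
        (p : 𝔓.1.adicCompletion (CyclotomicField m ℚ)) * z -
        (W.frobeniusTrace p : 𝔓.1.adicCompletion (CyclotomicField m ℚ)) *
          galAdicCompletionMap (sigma m w') (sigma_smul_eq_self_of_mul_coe_eq_one m p hpm w' hw' 𝔓) z +
        galAdicCompletionMap (sigma m w') (sigma_smul_eq_self_of_mul_coe_eq_one m p hpm w' hw' 𝔓)
          (galAdicCompletionMap (sigma m w') (sigma_smul_eq_self_of_mul_coe_eq_one m p hpm w' hw' 𝔓) z) := by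
  -- every model `V` EQUAL to the `instQ`-model inherits `hx`
  have hgen : ∀ {V : WeierstrassCurve (𝔓.1.adicCompletion (CyclotomicField m ℚ))}
      (_ : V = W.baseChange (𝔓.1.adicCompletion (CyclotomicField m ℚ))) [V.IsIntegral ν.integer]
      (P : V.toAffine.Point),
      Algebra.trace (((Rat.HeightOneSpectrum.primesEquiv (R := 𝓞 ℚ)).symm ⟨p, hp.out⟩).adicCompletion ℚ)
          (𝔓.1.adicCompletion (CyclotomicField m ℚ))
        (x * Literature.NumberTheory.EllipticCurves.FormalGroupChart.padicLogPointFiniteExt ν V p P) ∈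
      (((Rat.HeightOneSpectrum.primesEquiv (R := 𝓞 ℚ)).symm ⟨p, hp.out⟩).adicCompletionIntegers ℚ) := by
    intro V hV _ P
    subst hV
    exact hx P
  -- the canonical model (kport's currency) is integral for `ν` and EQUAL to the `instQ`-model
  haveI := Kw.isIntegral_baseChange_completion (p := p) (L := CyclotomicField m ℚ) (w := 𝔓) ν W
  refine exists_eq_eulerTwistLoc_of_forall_trace_padicLog_mul_mem' m p W hpm u w' hu hw' 𝔓 hp3 hΔ hap ht ν x
    (fun P => hgen ?_ P)
  rw [WeierstrassCurve.baseChange, WeierstrassCurve.baseChange]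
  congr 1
  exact Subsingleton.elim _ _

/-! ## §5 (appended) The `Ψ`-assembly step alone: per-factor memberships ⟹ the semi-local twist -/

/-- **Semi-local assembly from per-factor MEMBERSHIPS** (pure algebra; no curve hypothesis): if for every
`𝔓 ∣ p` the component `Ψ(v)_𝔓` satisfies `p·Ψ(v)_𝔓 = p·o − a·(σ_w)_𝔓 o + (σ_w)_𝔓((σ_w)_𝔓 o)` for some
`o ∈ 𝒪_𝔓` (the outputs of `…TwistedExpStarValues` at the datum's place and of
`KimAtThreeCyclotomicSigmaTransport.exists_eq_eulerTwistLoc_transport` at the others), then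
**`Σ_g coeff_g(p − a·[w] + [w²]) • (1 ⊗ σ_g) l = p · v` for some `l ∈ cycIntLattice p m`** (`l := Ψ⁻¹ o`).
[cite: CasselsFrohlichANT1967, Ch. II §10 (10.2)] [cite: Kim2022StructureSelmer, §3.4.1] -/
theorem exists_mem_cycIntLattice_eulerTwist_eq_of_forall_exists (hpm : ¬ p ∣ m) (w' : (ZMod m)ˣ)
    (hw' : (w' : ZMod m) * ((p : ℕ) : ZMod m) = 1)
    (Ψ : ℚ_[p] ⊗[ℚ] CyclotomicField m ℚ ≃ₐ[ℚ]
      (Π 𝔓 : ((Rat.HeightOneSpectrum.primesEquiv (R := 𝓞 ℚ)).symm ⟨p, hp.out⟩).Extension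
        (𝓞 (CyclotomicField m ℚ)), 𝔓.1.adicCompletion (CyclotomicField m ℚ)))
    (hΨ : ∀ (s : ℚ_[p]) (x : CyclotomicField m ℚ)
      (𝔓 : ((Rat.HeightOneSpectrum.primesEquiv (R := 𝓞 ℚ)).symm ⟨p, hp.out⟩).Extension
        (𝓞 (CyclotomicField m ℚ))),
      Ψ (s ⊗ₜ[ℚ] x) 𝔓 = algebraMap (CyclotomicField m ℚ) (𝔓.1.adicCompletion (CyclotomicField m ℚ)) x *
        algebraMap (((Rat.HeightOneSpectrum.primesEquiv (R := 𝓞 ℚ)).symm ⟨p, hp.out⟩).adicCompletion ℚ)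
          (𝔓.1.adicCompletion (CyclotomicField m ℚ)) (Padic.adicCompletionEquiv (𝓞 ℚ) ⟨p, hp.out⟩ s))
    (a : ℤ) (v : ℚ_[p] ⊗[ℚ] CyclotomicField m ℚ)
    (hv : ∀ 𝔓 : ((Rat.HeightOneSpectrum.primesEquiv (R := 𝓞 ℚ)).symm ⟨p, hp.out⟩).Extension
        (𝓞 (CyclotomicField m ℚ)),
      ∃ o ∈ 𝔓.1.adicCompletionIntegers (CyclotomicField m ℚ),
        (p : 𝔓.1.adicCompletion (CyclotomicField m ℚ)) * Ψ v 𝔓 =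
          (p : 𝔓.1.adicCompletion (CyclotomicField m ℚ)) * o -
            (a : 𝔓.1.adicCompletion (CyclotomicField m ℚ)) *
              galAdicCompletionMap (sigma m w') (sigma_smul_eq_self_of_mul_coe_eq_one m p hpm w' hw' 𝔓) o +
            galAdicCompletionMap (sigma m w') (sigma_smul_eq_self_of_mul_coe_eq_one m p hpm w' hw' 𝔓)
              (galAdicCompletionMap (sigma m w') (sigma_smul_eq_self_of_mul_coe_eq_one m p hpm w' hw' 𝔓) o)) :
    ∃ l ∈ Summit.BirchSwinnertonDyer.Rank1Residual.GaloisImage.cycIntLattice p m,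
      ∑ g : (ZMod m)ˣ, (((((p : ℕ) : MonoidAlgebra ℤ_[p] (ZMod m)ˣ) -
        MonoidAlgebra.single w' (a : ℤ_[p]) + MonoidAlgebra.single (w' ^ 2) (1 : ℤ_[p])).coeff g :
          ℤ_[p]) : ℚ_[p]) • Algebra.TensorProduct.map (AlgHom.id ℚ ℚ_[p])
            (sigma m g : CyclotomicField m ℚ →ₐ[ℚ] CyclotomicField m ℚ) l =
      (p : ℚ_[p] ⊗[ℚ] CyclotomicField m ℚ) * v := by
  classical
  choose o ho hoeq using hv
  refine ⟨Ψ.symm o, ?_, ?_⟩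
  · rw [mem_cycIntLattice_iff_forall_padicTensor_mem m p hpm Ψ hΨ]
    intro 𝔓
    rw [AlgEquiv.apply_symm_apply]
    exact ho 𝔓
  · apply Ψ.injective
    funext 𝔓
    have h := padicTensor_eulerTwist_apply m p (Ψ : ℚ_[p] ⊗[ℚ] CyclotomicField m ℚ →ₐ[ℚ] _) hΨ w' a 𝔓
      (sigma_smul_eq_self_of_mul_coe_eq_one m p hpm w' hw' 𝔓) (Ψ.symm o)
    rw [AlgEquiv.coe_toAlgHom] at h
    rw [h, map_mul, map_natCast, Pi.mul_apply, Pi.natCast_apply, AlgEquiv.apply_symm_apply]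
    exact (hoeq 𝔓).symm

end Summit.BirchSwinnertonDyer.BirchSwinnertonDyer.Theorems.KimAtThreeCyclotomicTwistedExpStarBound

end
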